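import Summits.QuantumFields.BalabanUV.T4Continuum.Support.NE4TransferModel
import Summits.QuantumFields.BalabanUV.Beta.GAN24.KSlotAssembly

/-!
# NE7EtaPropagatorSlot — route #1 of the NE7 crux, hardest stub S1∕L7 (`StepTransferModel.StepScaleShift`): the FLAT PROPAGATOR
# (K-)SLOT is INHABITED by an2's unit-normalised `U = 1` step resolvents `D_j·KInvStep Lc j·D_j` on ℤ⁴ with a rate `ρ < 1` — a MODEL
# instance of row NE4's one-step transfer model built from GAN24 road P1-fibre's kernel theorem `KSlotAssembly.convCKWall_holds`
# (companion of `Support/NE7EtaCovarianceSlot`, the covariance slot)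

Cell `pub-balaban`, rung (B)+1 sub-cell t4, lineage `b2b-balaban-t4-ne7-p1` (node U5 = NE7; generation 20 = CRUX PROVER NE7 #1 under
the coordinator ruling «YM REDIRECT» e34b3e0c), crux skeleton `HOME/t4/b2b-balaban-t4-ne7-p1-g20/ROUTE1-NE7.md` v1.1 §2 (stub S1, leaf L7)
∕ §5 (G2) «NE7-η» (refuter's PRICING-NE7 v1: «NE7-η GO, flat slots» AGREED).  HONEST FRAMING (page 1): FIXED FINITE T⁴, rung (B)+1 =
the `ε → 0` limit of unit-scale averaged expectations, CONDITIONAL on BetaPertH and the nine spine estimates (0/9 proved); NOT infinite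
volume, NOT a mass gap, NOT the Clay problem.  NE7 and NE4 are NOT PRINTED in [Balaban1984PropagatorsI]–[Balaban1989LargeFieldII] and NOT
proved here.

WHAT THIS FILE IS — AND IS NOT.  Leaf L7 `StepScaleShift b b_r ρ E₀ γ` of `Support/NE4TransferModel` asks that the one-step DATA of
Bałaban's transformation one level deeper differ by `≤ bρ^k`: «covariances `C^{(k)}`, propagators `G_k`, `H₁`, minimisers, O(η²) vertices»
(NOT PRINTED; [Balaban1987RG1] Thm 1 p. 259 is η-UNIFORMITY only).  `Support/NE7EtaCovarianceSlot` (p247856) inhabited its COVARIANCE slot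
from GAN24 road P2's `convC_balaban`.  The PROPAGATOR (K-)slot is the second flat constituent the G-an2-4 cell holds IN KERNEL: road
P1-fibre's END `KSlotAssembly.convCKWall_holds (hLc : 2 ≤ Lc) : CombesThomas.ConvCKWall 3 Lc` — for an2's unit-normalised step resolvents
`j ↦ unitK (sfStep Lc j) (smStep 3 Lc j) (KInvStep Lc j)` (the decimated composite resolvent of the step-`j` `U = 1` system in step-`j`
units, tree `Beta/OneStepKernelFamily.KInvStep`, `Beta/HessKerDressedUnits.unitK`) there are `C, δ > 0, cK, 0 ≤ θ < 1` with `j`-UNIFORM decay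
`Decays (K_j) C δ` and the Cauchy rate `Decays (K_{k+j} − K_k) (cK θ^k) δ` (`UnitDecayK` ∧ `CauchyDecayK`; headline discipline of that
file: «K-slot unconditional — NOT G-an2-4 closed»).  This file READS that theorem into route #1's socket: in the Banach space of
`e^{δ|x−y|₁}`-WEIGHTED bounded matrix-fibred kernels `(Site D × Site D × F × F →ᵇ ℝ)` the model with `N k c a = B k w =` the weighted
`K_k`, `W = 0`, `r = 0` satisfies `Represents`, L3–L6 and **L7 `StepScaleShift cK b_r θ C γ`** from the two `Decays` clauses alone
(§1 generic over `ExpKernelCalculus.MKer`; §2 the ℤ⁴ instance from `convCKWall_holds`).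
IT IS A MODEL INSTANCE OF THE PROPAGATOR SLOT ONLY: `W = 0` switches the history channel off, `r = 0` the β¹ read-out; the true instance
O1 couples the slots through the activity and reads the constrained minimisers at a general background (rows NE2∕NE3∕NE5).  So this file
does NOT discharge L7 for Bałaban's step and is NOT NE4 or NE7; it does NOT say «G-an2-4 closed» (the S∕W stencil slots, the window and
the identification (D1) of the G-an2-4 wall are untouched).  Value: the SECOND route-1 socket inhabited by a Bałaban-typed object through
a kernel theorem on explicit lattice operators; together with the covariance slot, every flat `U = 1` constituent family the cell holds
in kernel now sits in L7's shape with a rate `< 1`.  [folklore] bookkeeping; no cite tags; nothing printed is asserted; no `def`.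
-/

noncomputable section

open BoundedContinuousFunction

namespace Summit.QuantumFields.BalabanUV.T4Continuum.NE7EtaPropagatorSlot

open Literature.MathematicalPhysics.QuantumFieldTheory.Balaban1983to89
open Literature.MathematicalPhysics.QuantumFieldTheory.Balaban1983to89.Beta
open B12Sec2to5 (l1 l1_nonneg)
open ExpKernelCalculus (Site MKer Decays)
open OneStepResolventKernel (Fib)
open OneStepKernelFamily (KInvStep)
open Summit.QuantumFields.BalabanUV.Beta.HessKerDressedUnits (unitK)
open Summit.QuantumFields.BalabanUV.Beta.GAN24.CombesThomas (ConvCKWall UnitDecayK CauchyDecayK UniformDecays DecayCauchy sfStep smStep)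
open Summit.QuantumFields.BalabanUV.Beta.GAN24.KSlotAssembly (convCKWall_holds)
open Summit.QuantumFields.BalabanUV.T4Continuum.NE4TransferModel (StepTransferModel)

variable {D : ℕ} {F : Type*}

/-! ## §1 Generic: a uniformly decaying kernel family with a one-step decaying rate inhabits the propagator slot -/

/-- The weighted kernel `(x,y,a,b) ↦ K_k x y a b · e^{δ|x−y|₁}` is bounded by `C` under `Decays (K k) C δ`. [folklore] -/
theorem weighted_le {K : ℕ → MKer D F} {C δ : ℝ} (hU : UniformDecays K C δ) (k : ℕ)
    (z : Site D × Site D × F × F) : ‖K k z.1 z.2.1 z.2.2.1 z.2.2.2 * Real.exp (δ * l1 (z.1 - z.2.1))‖ ≤ C := by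
  rw [Real.norm_eq_abs, abs_mul, abs_of_pos (Real.exp_pos _)]
  have h := hU k z.1 z.2.1 z.2.2.1 z.2.2.2
  have hexp : 0 < Real.exp (δ * l1 (z.1 - z.2.1)) := Real.exp_pos _
  calc |K k z.1 z.2.1 z.2.2.1 z.2.2.2| * Real.exp (δ * l1 (z.1 - z.2.1))
      ≤ C * Real.exp (-δ * l1 (z.1 - z.2.1)) * Real.exp (δ * l1 (z.1 - z.2.1)) := mul_le_mul_of_nonneg_right h hexp.le
    _ = C := by rw [mul_assoc, ← Real.exp_add, neg_mul, neg_add_cancel, Real.exp_zero, mul_one]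

/-- The weighted one-step difference is bounded by `cK·θ^k` under `Decays (K (k+1) − K k) (cK θ^k) δ`. [folklore] -/
theorem weighted_sub_le {K : ℕ → MKer D F} {cK θ δ : ℝ} (hS : ∀ k, Decays (K (k + 1) - K k) (cK * θ ^ k) δ) (k : ℕ)
    (z : Site D × Site D × F × F) :
    ‖K (k + 1) z.1 z.2.1 z.2.2.1 z.2.2.2 * Real.exp (δ * l1 (z.1 - z.2.1)) -
        K k z.1 z.2.1 z.2.2.1 z.2.2.2 * Real.exp (δ * l1 (z.1 - z.2.1))‖ ≤ cK * θ ^ k := by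
  rw [← sub_mul, Real.norm_eq_abs, abs_mul, abs_of_pos (Real.exp_pos _)]
  have h := hS k z.1 z.2.1 z.2.2.1 z.2.2.2
  rw [Pi.sub_apply, Pi.sub_apply, Pi.sub_apply, Pi.sub_apply] at h
  have hexp : 0 < Real.exp (δ * l1 (z.1 - z.2.1)) := Real.exp_pos _
  calc |K (k + 1) z.1 z.2.1 z.2.2.1 z.2.2.2 - K k z.1 z.2.1 z.2.2.1 z.2.2.2| * Real.exp (δ * l1 (z.1 - z.2.1))
      ≤ cK * θ ^ k * Real.exp (-δ * l1 (z.1 - z.2.1)) * Real.exp (δ * l1 (z.1 - z.2.1)) :=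
        mul_le_mul_of_nonneg_right h hexp.le
    _ = cK * θ ^ k := by rw [mul_assoc, ← Real.exp_add, neg_mul, neg_add_cancel, Real.exp_zero, mul_one]

/-- One-step rates from the Cauchy form: `DecayCauchy K cK θ δ → ∀ k, Decays (K (k+1) − K k) (cK θ^k) δ` (`j = 1`). [folklore] -/
theorem step_of_decayCauchy {K : ℕ → MKer D F} {cK θ δ : ℝ} (h : DecayCauchy K cK θ δ) :
    ∀ k, Decays (K (k + 1) - K k) (cK * θ ^ k) δ := fun k => h k 1

/-- **THE PROPAGATOR-SLOT MODEL FROM UNIFORM DECAY + ONE-STEP RATE.**  For a family `K k` of matrix-fibred kernels on `ℤ^D` with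
`UniformDecays K C δ` and `Decays (K (k+1) − K k) (cK θ^k) δ` (`θ ≥ 0`, fibre inhabited), there is a one-step transfer model `M` on the
Banach space of `e^{δ|x−y|₁}`-weighted bounded kernels whose stored and new brackets ARE the weighted `K k` (displayed), with `W = 0`,
`r = 0`, satisfying `Represents`, L3 `TransferBound` (any `C_W, ω ≥ 0`), L4 `ActivityLipschitz`, L5 `CouplingLipschitz`, L6 `Admissible C`,
and **L7 `StepScaleShift cK b_r θ E₀ γ`** (any `b_r ≥ 0`).  MODEL instance of the propagator slot only — NOT O1. [folklore] -/
theorem model_of_decays [TopologicalSpace F] [DiscreteTopology F] {K : ℕ → MKer D F} {C δ cK θ : ℝ}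
    (hU : UniformDecays K C δ)
    (hS : ∀ k, Decays (K (k + 1) - K k) (cK * θ ^ k) δ) (hθ : 0 ≤ θ) (a₀ : F) :
    ∃ M : StepTransferModel (Site D × Site D × F × F →ᵇ ℝ) (Site D × Site D × F × F →ᵇ ℝ),
      (∀ k c a z, M.N k c a z = K k z.1 z.2.1 z.2.2.1 z.2.2.2 * Real.exp (δ * l1 (z.1 - z.2.1))) ∧
      (∀ k w z, M.B k w z = K k z.1 z.2.1 z.2.2.1 z.2.2.2 * Real.exp (δ * l1 (z.1 - z.2.1))) ∧
      (∀ k c, M.W k c = 0) ∧ (∀ k c a, M.r k c a = 0) ∧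
      (∀ γ, M.Represents γ) ∧
      (∀ C_W ω γ : ℝ, 0 ≤ C_W → 0 ≤ ω → M.TransferBound C_W ω γ) ∧
      (∀ C_F C_r E₀ γ : ℝ, 0 ≤ C_F → 0 ≤ C_r → M.ActivityLipschitz C_F C_r E₀ γ) ∧
      (∀ ℓ' ℓ E₀ γ : ℝ, 0 ≤ ℓ' → 0 ≤ ℓ → M.CouplingLipschitz ℓ' ℓ E₀ γ) ∧
      (∀ γ, M.Admissible C γ) ∧
      (∀ b_r E₀ γ : ℝ, 0 ≤ b_r → M.StepScaleShift cK b_r θ E₀ γ) := by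
  have hC : 0 ≤ C := (hU 0).nonneg a₀
  have hcK : 0 ≤ cK := by
    have h := (hS 0).nonneg a₀
    simpa using h
  let wk : ℕ → (Site D × Site D × F × F →ᵇ ℝ) := fun k =>
    ofNormedAddCommGroupDiscrete (fun z => K k z.1 z.2.1 z.2.2.1 z.2.2.2 * Real.exp (δ * l1 (z.1 - z.2.1))) C
      (weighted_le hU k)
  have hwk : ∀ k z, wk k z = K k z.1 z.2.1 z.2.2.1 z.2.2.2 * Real.exp (δ * l1 (z.1 - z.2.1)) := fun k z => rfl
  have hnorm : ∀ k, ‖wk k‖ ≤ C := fun k => (norm_le hC).2 (weighted_le hU k)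
  have hstep : ∀ k, ‖wk (k + 1) - wk k‖ ≤ cK * θ ^ k := fun k =>
    (norm_le (by positivity)).2 fun z => by
      rw [BoundedContinuousFunction.sub_apply, hwk, hwk]
      exact weighted_sub_le hS k z
  refine ⟨{ W := fun _ _ => 0, N := fun k _ _ => wk k, r := fun _ _ _ => 0, B := fun k _ => wk k },
    fun k c a z => rfl, fun k w z => rfl, fun k c => rfl, fun k c a => rfl, ?_, ?_, ?_, ?_, ?_, ?_⟩
  · intro γ k g _
    rfl
  · intro C_W ω γ hCW hω k c E _ _
    simp only [LinearMap.zero_apply, norm_zero]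
    exact mul_nonneg hCW (Finset.sum_nonneg fun j _ => mul_nonneg (pow_nonneg hω _) (norm_nonneg _))
  · intro C_F C_r E₀ γ hCF hCr k c E E' _ _ _ _
    simp only [sub_self, norm_zero, abs_zero]
    exact ⟨mul_nonneg hCF (norm_nonneg _), mul_nonneg hCr (norm_nonneg _)⟩
  · intro ℓ' ℓ E₀ γ hℓ' hℓ k c c' E _ _ _ _ _
    simp only [sub_self, norm_zero, abs_zero]
    exact ⟨mul_nonneg hℓ' (abs_nonneg _), mul_nonneg hℓ (abs_nonneg _)⟩
  · intro γ k g _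
    exact hnorm k
  · intro b_r E₀ γ hbr k c E _ _ _
    refine ⟨hstep k, ?_⟩
    simp only [sub_self, abs_zero]
    exact mul_nonneg hbr (pow_nonneg hθ _)

/-! ## §2 The Bałaban-typed instance on ℤ⁴: an2's unit-normalised step resolvents via `convCKWall_holds` -/

/-- **AN2's UNIT-NORMALISED `U = 1` STEP RESOLVENTS ON ℤ⁴ INHABIT THE PROPAGATOR SLOT OF L7 WITH A RATE `θ < 1`.**  For every block size
`Lc ≥ 2` there are `C ≥ 0`, `δ > 0`, `cK`, `0 ≤ θ < 1` (GAN24 road P1-fibre's `KSlotAssembly.convCKWall_holds`) and a transfer model `M` on the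
weighted kernel space over `Site 4 × Site 4 × Fib 3 × Fib 3` whose brackets ARE the weighted `unitK (sfStep Lc k) (smStep 3 Lc k) (KInvStep Lc k)`
(displayed) and which satisfies `Represents`, L3–L6 and **`M.StepScaleShift cK b_r θ E₀ γ`**.  Propagator slot only (`W = 0`, `r = 0`); NOT
O1, NOT NE4, NOT NE7, NOT «G-an2-4 closed». [folklore] -/
theorem model_an2StepResolvents (Lc : ℕ) [NeZero Lc] (hLc : 2 ≤ Lc) :
    ∃ (C δ cK θ : ℝ) (M : StepTransferModel (Site 4 × Site 4 × Fib 3 × Fib 3 →ᵇ ℝ) (Site 4 × Site 4 × Fib 3 × Fib 3 →ᵇ ℝ)),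
      0 ≤ C ∧ 0 < δ ∧ 0 ≤ θ ∧ θ < 1 ∧
      (∀ k c a z, M.N k c a z =
        unitK (sfStep Lc k) (smStep 3 Lc k) (KInvStep (d := 3) Lc k) z.1 z.2.1 z.2.2.1 z.2.2.2 * Real.exp (δ * l1 (z.1 - z.2.1))) ∧
      (∀ k w z, M.B k w z =
        unitK (sfStep Lc k) (smStep 3 Lc k) (KInvStep (d := 3) Lc k) z.1 z.2.1 z.2.2.1 z.2.2.2 * Real.exp (δ * l1 (z.1 - z.2.1))) ∧
      (∀ k c, M.W k c = 0) ∧ (∀ k c a, M.r k c a = 0) ∧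
      (∀ γ, M.Represents γ) ∧
      (∀ C_W ω γ : ℝ, 0 ≤ C_W → 0 ≤ ω → M.TransferBound C_W ω γ) ∧
      (∀ C_F C_r E₀ γ : ℝ, 0 ≤ C_F → 0 ≤ C_r → M.ActivityLipschitz C_F C_r E₀ γ) ∧
      (∀ ℓ' ℓ E₀ γ : ℝ, 0 ≤ ℓ' → 0 ≤ ℓ → M.CouplingLipschitz ℓ' ℓ E₀ γ) ∧
      (∀ γ, M.Admissible C γ) ∧
      (∀ b_r E₀ γ : ℝ, 0 ≤ b_r → M.StepScaleShift cK b_r θ E₀ γ) := by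
  obtain ⟨C, δ, cK, θ, hδ, hθ0, hθ1, hU, hCauchy⟩ := convCKWall_holds (Lc := Lc) hLc
  have hU' : UniformDecays (fun j => unitK (sfStep Lc j) (smStep 3 Lc j) (KInvStep (d := 3) Lc j)) C δ := hU
  have hS := step_of_decayCauchy (K := fun j => unitK (sfStep Lc j) (smStep 3 Lc j) (KInvStep (d := 3) Lc j)) hCauchy
  obtain ⟨M, hN, hB, hW, hr, hRep, hT, hA, hCL, hAdm, hSt⟩ := model_of_decays hU' hS hθ0 (Sum.inl 0)
  exact ⟨C, δ, cK, θ, M, (hU' 0).nonneg (Sum.inl 0), hδ, hθ0, hθ1, hN, hB, hW, hr, hRep, hT, hA, hCL, hAdm, hSt⟩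

end Summit.QuantumFields.BalabanUV.T4Continuum.NE7EtaPropagatorSlot

end
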